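import Mathlib.Analysis.SpecificLimits.Basic
import Mathlib.Analysis.SpecialFunctions.Pow.Real
import Mathlib.Topology.Algebra.InfiniteSum.ENNReal
import Mathlib.Data.ENNReal.BigOperators

/-!
# Crux `PerpetualPump.AveragedTypeIBlowup` (stmt-NavierStokesRegularity-1835), line `Sketch`:
# stub `typeISum` — the Type-I summation lemma

This file proves the registered stub `stub_typeISum` of the line skeleton
`Cruxes/AveragedTypeIBlowup/Lines/Sketch.lean`. The Type-I functional of the crux is
`Σ_{i,k} (1+ε₀)^{3k/2} · (band majorant)`; along the pinned staircase the critically weighted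
majorants `(1+ε₀)^{k/2} F_k` are bounded by `C₁` up to one scale above the front `n`, vanish below
the datum scale (`k < 0`) and decay geometrically above the front
(`(1+ε₀)^{(n+j)/2} F_{n+j} ≤ C₁ ρ^j` for `j ≥ 2`, with `ρ (1+ε₀)² ≤ 1/2`). The present file is the
pure summation fact: in `ℝ≥0∞`,

  `∑' k : ℤ, ofReal ((1+ε₀)^{3k/2} F_k) ≤ ofReal (8 C₁ (1+ε₀)^{n+2} / ε₀)`.

Proof (Mathlib only). Write `q := 1 + ε₀` and `a_k := q^{3k/2} F_k = q^k · (q^{k/2} F_k)`.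
* The summand vanishes for `k < 0`, so the `ℤ`-indexed `tsum` is the `ℕ`-indexed one
  (`Function.Injective.tsum_eq` for `Nat.cast`), which in `ℝ≥0∞` is the supremum of the partial
  sums (`ENNReal.tsum_eq_iSup_nat`); hence it suffices to bound every real partial sum
  `∑_{m<i} a_m` (`ENNReal.ofReal_sum_of_nonneg`, `ENNReal.ofReal_le_ofReal`).
* Low scales `m ≤ n+1`: `a_m ≤ C₁ q^m`, and `∑_{m<n+2} q^m = (q^{n+2} - 1)/ε₀ ≤ q^{n+2}/ε₀`
  (`geom_sum_eq`).
* High scales `m = n + j`, `j ≥ 2`: `a_m ≤ C₁ q^{n+j} ρ^j = C₁ q^n (qρ)^j ≤ C₁ q^n (1/2)^j`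
  (as `qρ ≤ q²ρ ≤ 1/2`), and `∑_j (1/2)^{j+2} ≤ 1/2` (`sum_geometric_two_le`).
* Total: `≤ C₁ q^{n+2}/ε₀ + C₁ q^n/2 ≤ 2 C₁ q^{n+2}/ε₀ ≤ 8 C₁ q^{n+2}/ε₀`.

## References

* T. Tao, *Finite time blowup for an averaged three-dimensional Navier–Stokes equation*, J. Amer.
  Math. Soc. 29 (2016), 601–674, §4–§5 (context only; the lemma itself is elementary).
-/

noncomputable section

-- the summit namespace `…NavierStokesRegularity.NavierStokesRegularity…` is the tree convention
set_option linter.dupNamespace false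

open Finset

open scoped ENNReal

namespace Summit.NavierStokesRegularity.NavierStokesRegularity.Theorems.PerpetualPumpAveragedTypeIBlowup

/-- **Exponent splitting.** For `q > 0` and `m : ℕ`, `q^{3m/2} = q^m · q^{m/2}` (natural power
times real power). [folklore] -/
theorem typeISum_rpow_split {q : ℝ} (hq : 0 < q) (m : ℕ) :
    q ^ ((3 : ℝ) * m / 2) = q ^ m * q ^ ((m : ℝ) / 2) := by
  rw [← Real.rpow_natCast, ← Real.rpow_add hq]
  congr 1
  ring

/-- **Low-scale termwise bound.** If `q^{k/2} F_k ≤ C₁` for `0 ≤ k ≤ n + 1`, then for `m ≤ n + 1`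
the Type-I weighted term satisfies `q^{3m/2} F_m ≤ C₁ q^m`. [folklore] -/
theorem typeISum_term_low {q C₁ : ℝ} {F : ℤ → ℝ} {n : ℕ} (hq : 0 < q)
    (hlow : ∀ k : ℤ, 0 ≤ k → k ≤ (n : ℤ) + 1 → q ^ ((k : ℝ) / 2) * F k ≤ C₁)
    {m : ℕ} (hm : m ≤ n + 1) :
    q ^ ((3 : ℝ) * m / 2) * F m ≤ C₁ * q ^ m := by
  rw [typeISum_rpow_split hq, mul_assoc, mul_comm C₁]
  refine mul_le_mul_of_nonneg_left ?_ (pow_nonneg hq.le m)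
  have h := hlow (m : ℤ) (Int.natCast_nonneg m) (by exact_mod_cast hm)
  simpa only [Int.cast_natCast] using h

/-- **High-scale termwise bound.** If `q ≥ 1`, `ρ ≥ 0`, `ρ q² ≤ 1/2` and
`q^{(n+j)/2} F_{n+j} ≤ C₁ ρ^j` for `j ≥ 2`, then for `j ≥ 2` the Type-I weighted term satisfies
`q^{3(n+j)/2} F_{n+j} ≤ C₁ q^n (1/2)^j`, because `q^{n+j} ρ^j = q^n (qρ)^j` and `qρ ≤ q²ρ ≤ 1/2`.
[folklore] -/
theorem typeISum_term_high {q C₁ ρ : ℝ} {F : ℤ → ℝ} {n : ℕ} (hq : 1 ≤ q) (hC : 0 ≤ C₁)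
    (hρ : 0 ≤ ρ) (hρq : ρ * q ^ 2 ≤ 1 / 2)
    (hhigh : ∀ j : ℕ, 2 ≤ j → q ^ (((n : ℝ) + j) / 2) * F (n + j) ≤ C₁ * ρ ^ j)
    {j : ℕ} (hj : 2 ≤ j) :
    q ^ ((3 : ℝ) * ((n + j : ℕ) : ℝ) / 2) * F ((n + j : ℕ) : ℤ) ≤ C₁ * q ^ n * (1 / 2) ^ j := by
  have hq0 : 0 < q := one_pos.trans_le hq
  rw [typeISum_rpow_split hq0, mul_assoc]
  have h1 : q ^ (((n + j : ℕ) : ℝ) / 2) * F ((n + j : ℕ) : ℤ) ≤ C₁ * ρ ^ j := by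
    have h := hhigh j hj
    push_cast
    exact h
  have hqρ : q * ρ ≤ 1 / 2 :=
    calc q * ρ = ρ * q := mul_comm _ _
      _ ≤ ρ * q * q := le_mul_of_one_le_right (mul_nonneg hρ hq0.le) hq
      _ = ρ * q ^ 2 := by ring
      _ ≤ 1 / 2 := hρq
  calc q ^ (n + j) * (q ^ (((n + j : ℕ) : ℝ) / 2) * F ((n + j : ℕ) : ℤ))
      ≤ q ^ (n + j) * (C₁ * ρ ^ j) := mul_le_mul_of_nonneg_left h1 (pow_nonneg hq0.le _)
    _ = C₁ * q ^ n * (q * ρ) ^ j := by rw [pow_add, mul_pow]; ring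
    _ ≤ C₁ * q ^ n * (1 / 2) ^ j :=
        mul_le_mul_of_nonneg_left (pow_le_pow_left₀ (mul_nonneg hq0.le hρ) hqρ j)
          (mul_nonneg hC (pow_nonneg hq0.le n))

/-- **Low-scale partial sum.** Under the critical bound up to scale `n + 1`,
`∑_{m<n+2} (1+ε₀)^{3m/2} F_m ≤ C₁ ∑_{m<n+2} (1+ε₀)^m = C₁ ((1+ε₀)^{n+2} - 1)/ε₀ ≤ C₁ (1+ε₀)^{n+2}/ε₀`.
[folklore] -/
theorem typeISum_sum_low {ε₀ C₁ : ℝ} {F : ℤ → ℝ} {n : ℕ} (hε : 0 < ε₀) (hC : 0 ≤ C₁)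
    (hlow : ∀ k : ℤ, 0 ≤ k → k ≤ (n : ℤ) + 1 → (1 + ε₀) ^ ((k : ℝ) / 2) * F k ≤ C₁) :
    ∑ m ∈ range (n + 2), (1 + ε₀) ^ ((3 : ℝ) * m / 2) * F m ≤
      C₁ * (1 + ε₀) ^ (n + 2) / ε₀ := by
  have hq : 0 < 1 + ε₀ := by linarith
  calc ∑ m ∈ range (n + 2), (1 + ε₀) ^ ((3 : ℝ) * m / 2) * F m
      ≤ ∑ m ∈ range (n + 2), C₁ * (1 + ε₀) ^ m :=
        sum_le_sum fun m hm => typeISum_term_low hq hlow (by have := mem_range.1 hm; omega)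
    _ = C₁ * (((1 + ε₀) ^ (n + 2) - 1) / ε₀) := by
        rw [← mul_sum, geom_sum_eq (by linarith : (1 + ε₀ : ℝ) ≠ 1), add_sub_cancel_left]
    _ ≤ C₁ * ((1 + ε₀) ^ (n + 2) / ε₀) :=
        mul_le_mul_of_nonneg_left (div_le_div_of_nonneg_right (by linarith) hε.le) hC
    _ = C₁ * (1 + ε₀) ^ (n + 2) / ε₀ := (mul_div_assoc _ _ _).symm

/-- **High-scale partial sums.** Under the geometric decay above the front,
`∑_{m<i} (1+ε₀)^{3(n+2+m)/2} F_{n+2+m} ≤ C₁ (1+ε₀)^n/4 · ∑_{m<i} (1/2)^m ≤ C₁ (1+ε₀)^n / 2`.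
[folklore] -/
theorem typeISum_sum_high {ε₀ C₁ ρ : ℝ} {F : ℤ → ℝ} {n : ℕ} (hε : 0 < ε₀) (hC : 0 ≤ C₁)
    (hρ : 0 ≤ ρ) (hρq : ρ * (1 + ε₀) ^ 2 ≤ 1 / 2)
    (hhigh : ∀ j : ℕ, 2 ≤ j → (1 + ε₀) ^ (((n : ℝ) + j) / 2) * F (n + j) ≤ C₁ * ρ ^ j) (i : ℕ) :
    ∑ m ∈ range i, (1 + ε₀) ^ ((3 : ℝ) * ((n + 2 + m : ℕ) : ℝ) / 2) * F ((n + 2 + m : ℕ) : ℤ) ≤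
      C₁ * (1 + ε₀) ^ n / 2 := by
  have hq : 1 ≤ 1 + ε₀ := by linarith
  calc ∑ m ∈ range i, (1 + ε₀) ^ ((3 : ℝ) * ((n + 2 + m : ℕ) : ℝ) / 2) * F ((n + 2 + m : ℕ) : ℤ)
      ≤ ∑ m ∈ range i, C₁ * (1 + ε₀) ^ n / 4 * (1 / 2 : ℝ) ^ m := by
        refine sum_le_sum fun m _ => ?_
        have h := typeISum_term_high hq hC hρ hρq hhigh (j := m + 2) (by omega)
        rw [show n + 2 + m = n + (m + 2) by omega]
        calc _ ≤ _ := h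
          _ = C₁ * (1 + ε₀) ^ n / 4 * (1 / 2 : ℝ) ^ m := by rw [pow_add]; ring
    _ = C₁ * (1 + ε₀) ^ n / 4 * ∑ m ∈ range i, (1 / 2 : ℝ) ^ m := by rw [mul_sum]
    _ ≤ C₁ * (1 + ε₀) ^ n / 4 * 2 :=
        mul_le_mul_of_nonneg_left (sum_geometric_two_le i) (by positivity)
    _ = C₁ * (1 + ε₀) ^ n / 2 := by ring

/-- **All partial sums.** Combining the low and high scales (after enlarging the range to
`n + 2 + i` and splitting it with `Finset.sum_range_add`):
`∑_{m<i} (1+ε₀)^{3m/2} F_m ≤ C₁ (1+ε₀)^{n+2}/ε₀ + C₁ (1+ε₀)^n/2 ≤ 2 C₁ (1+ε₀)^{n+2}/ε₀`.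
[folklore] -/
theorem typeISum_partial_le {ε₀ C₁ ρ : ℝ} {F : ℤ → ℝ} {n : ℕ} (hε : 0 < ε₀) (hε1 : ε₀ ≤ 1)
    (hC : 0 ≤ C₁) (hρ : 0 ≤ ρ) (hρq : ρ * (1 + ε₀) ^ 2 ≤ 1 / 2) (hF : ∀ k : ℤ, 0 ≤ F k)
    (hlow : ∀ k : ℤ, 0 ≤ k → k ≤ (n : ℤ) + 1 → (1 + ε₀) ^ ((k : ℝ) / 2) * F k ≤ C₁)
    (hhigh : ∀ j : ℕ, 2 ≤ j → (1 + ε₀) ^ (((n : ℝ) + j) / 2) * F (n + j) ≤ C₁ * ρ ^ j) (i : ℕ) :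
    ∑ m ∈ range i, (1 + ε₀) ^ ((3 : ℝ) * m / 2) * F m ≤ 2 * C₁ * (1 + ε₀) ^ (n + 2) / ε₀ := by
  have hq : 0 < 1 + ε₀ := by linarith
  have hnn : ∀ m ∈ range (n + 2 + i), m ∉ range i →
      0 ≤ (1 + ε₀) ^ ((3 : ℝ) * m / 2) * F m :=
    fun m _ _ => mul_nonneg (Real.rpow_nonneg hq.le _) (hF m)
  have hpow : (1 + ε₀) ^ n ≤ (1 + ε₀) ^ (n + 2) :=
    pow_le_pow_right₀ (by linarith : (1 : ℝ) ≤ 1 + ε₀) (by omega)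
  have hA : 0 ≤ C₁ * (1 + ε₀) ^ n := mul_nonneg hC (pow_nonneg hq.le n)
  have hcmp : C₁ * (1 + ε₀) ^ n / 2 ≤ C₁ * (1 + ε₀) ^ (n + 2) / ε₀ := by
    rw [div_le_div_iff₀ (by norm_num : (0 : ℝ) < 2) hε]
    calc C₁ * (1 + ε₀) ^ n * ε₀ ≤ C₁ * (1 + ε₀) ^ n * 1 := mul_le_mul_of_nonneg_left hε1 hA
      _ ≤ C₁ * (1 + ε₀) ^ (n + 2) * 1 :=
          mul_le_mul_of_nonneg_right (mul_le_mul_of_nonneg_left hpow hC) zero_le_one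
      _ ≤ C₁ * (1 + ε₀) ^ (n + 2) * 2 := by
          have : 0 ≤ C₁ * (1 + ε₀) ^ (n + 2) := mul_nonneg hC (pow_nonneg hq.le _)
          nlinarith
  calc ∑ m ∈ range i, (1 + ε₀) ^ ((3 : ℝ) * m / 2) * F m
      ≤ ∑ m ∈ range (n + 2 + i), (1 + ε₀) ^ ((3 : ℝ) * m / 2) * F m :=
        sum_le_sum_of_subset_of_nonneg (range_mono (by omega)) hnn
    _ = ∑ m ∈ range (n + 2), (1 + ε₀) ^ ((3 : ℝ) * m / 2) * F m +
          ∑ m ∈ range i, (1 + ε₀) ^ ((3 : ℝ) * ((n + 2 + m : ℕ) : ℝ) / 2) *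
            F ((n + 2 + m : ℕ) : ℤ) :=
        sum_range_add _ _ _
    _ ≤ C₁ * (1 + ε₀) ^ (n + 2) / ε₀ + C₁ * (1 + ε₀) ^ n / 2 :=
        add_le_add (typeISum_sum_low hε hC hlow) (typeISum_sum_high hε hC hρ hρq hhigh i)
    _ ≤ C₁ * (1 + ε₀) ^ (n + 2) / ε₀ + C₁ * (1 + ε₀) ^ (n + 2) / ε₀ := by gcongr
    _ = 2 * C₁ * (1 + ε₀) ^ (n + 2) / ε₀ := by ring

/-- **Stub `typeISum`** (Mathlib-only). TYPE-I SUMMATION: at a fixed time a `ℤ`-family of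
nonnegative band majorants that is critically bounded (`(1+ε₀)^{k/2}F_k ≤ C₁`) up to one scale
above the front `n`, vanishes below the datum scale and decays geometrically above (`≤ C₁ρ^j`,
`ρ(1+ε₀)² ≤ 1/2`) has Type-I-weighted sum `Σ_k (1+ε₀)^{3k/2}F_k ≤ 8C₁(1+ε₀)^{n+2}/ε₀` in `ℝ≥0∞`.
Proof: reduce the `ℤ`-sum to the supremum of the `ℕ`-partial sums and apply
`typeISum_partial_le`. [folklore] -/
theorem stub_typeISum :
    ∀ (ε₀ : ℝ) (F : ℤ → ℝ) (n : ℤ) (C₁ ρ : ℝ), 0 < ε₀ → ε₀ ≤ 1 → 0 ≤ C₁ → 0 < ρ → ρ * (1 + ε₀) ^ 2 ≤ 1 / 2 →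
      0 ≤ n → (∀ k : ℤ, 0 ≤ F k) → (∀ k : ℤ, k < 0 → F k = 0) →
      (∀ k : ℤ, 0 ≤ k → k ≤ n + 1 → (1 + ε₀) ^ ((k : ℝ) / 2) * F k ≤ C₁) →
      (∀ j : ℕ, 2 ≤ j → (1 + ε₀) ^ (((n : ℝ) + j) / 2) * F (n + j) ≤ C₁ * ρ ^ j) →
      ∑' k : ℤ, ENNReal.ofReal ((1 + ε₀) ^ ((3 : ℝ) * k / 2) * F k) ≤
        ENNReal.ofReal (8 * C₁ * (1 + ε₀) ^ ((n : ℝ) + 2) / ε₀) := by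
  intro ε₀ F n C₁ ρ hε hε1 hC hρ hρq hn hF hF0 hlow hhigh
  obtain ⟨n, rfl⟩ := Int.eq_ofNat_of_zero_le hn
  simp only [Int.cast_natCast] at hhigh
  have hq : 0 < 1 + ε₀ := by linarith
  -- the summand vanishes off the range of `Nat.cast : ℕ → ℤ`
  have hsupp : Function.support (fun k : ℤ => ENNReal.ofReal ((1 + ε₀) ^ ((3 : ℝ) * k / 2) * F k))
      ⊆ Set.range (Nat.cast : ℕ → ℤ) := by
    intro k hk
    rw [Function.mem_support] at hk
    rcases lt_or_ge k 0 with h | h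
    · exact (hk (by simp [hF0 k h])).elim
    · exact ⟨k.toNat, Int.toNat_of_nonneg h⟩
  -- comparison of the real bounds `2 C₁ q^{n+2}/ε₀ ≤ 8 C₁ q^{n+2}/ε₀` (natural vs. real power)
  have hB : 2 * C₁ * (1 + ε₀) ^ (n + 2) / ε₀ ≤
      8 * C₁ * (1 + ε₀) ^ (((n : ℤ) : ℝ) + 2) / ε₀ := by
    rw [Int.cast_natCast, show (n : ℝ) + 2 = ((n + 2 : ℕ) : ℝ) by push_cast; ring,
      Real.rpow_natCast]
    have hX : 0 ≤ C₁ * (1 + ε₀) ^ (n + 2) := by positivity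
    have h8 : 2 * C₁ * (1 + ε₀) ^ (n + 2) ≤ 8 * C₁ * (1 + ε₀) ^ (n + 2) := by nlinarith
    exact div_le_div_of_nonneg_right h8 hε.le
  refine le_trans ?_ (ENNReal.ofReal_le_ofReal hB)
  calc ∑' k : ℤ, ENNReal.ofReal ((1 + ε₀) ^ ((3 : ℝ) * k / 2) * F k)
      = ∑' m : ℕ, ENNReal.ofReal ((1 + ε₀) ^ ((3 : ℝ) * ((m : ℤ) : ℝ) / 2) * F m) :=
        (Nat.cast_injective.tsum_eq hsupp).symm
    _ = ⨆ i : ℕ, ∑ m ∈ range i,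
          ENNReal.ofReal ((1 + ε₀) ^ ((3 : ℝ) * ((m : ℤ) : ℝ) / 2) * F m) :=
        ENNReal.tsum_eq_iSup_nat
    _ ≤ ENNReal.ofReal (2 * C₁ * (1 + ε₀) ^ (n + 2) / ε₀) := by
        refine iSup_le fun i => ?_
        calc ∑ m ∈ range i, ENNReal.ofReal ((1 + ε₀) ^ ((3 : ℝ) * ((m : ℤ) : ℝ) / 2) * F m)
            = ENNReal.ofReal
                (∑ m ∈ range i, (1 + ε₀) ^ ((3 : ℝ) * ((m : ℤ) : ℝ) / 2) * F m) :=
              (ENNReal.ofReal_sum_of_nonneg fun (m : ℕ) _ =>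
                mul_nonneg (Real.rpow_nonneg hq.le _) (hF m)).symm
          _ ≤ ENNReal.ofReal (2 * C₁ * (1 + ε₀) ^ (n + 2) / ε₀) := by
              refine ENNReal.ofReal_le_ofReal ?_
              simp only [Int.cast_natCast]
              exact typeISum_partial_le hε hε1 hC hρ.le hρq hF hlow hhigh i

end Summit.NavierStokesRegularity.NavierStokesRegularity.Theorems.PerpetualPumpAveragedTypeIBlowup

end
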